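import Summits.AtomisticToContinuum.HydrodynamicLimit.Theorems.OneFlightGossipEngineClampedCurrentsDockHeartTools
import Summits.AtomisticToContinuum.HydrodynamicLimit.Theorems.OneFlightGossipEngineClampedCurrentsDockClampRemainder
import Summits.AtomisticToContinuum.HydrodynamicLimit.Theorems.OneFlightGossipEngineKacPairHeatFlux
import HarnessLib

/-!
# The heart of Yau's entropy ledger — pathwise bookkeeping on one window (crux `ClampedCurrentsDock`, stmt-14680, line `IdeatorTwoSketch`)

Helper file (`--supports stmt-AtomisticToContinuum-14680`) for the registered stub `stub_oneWindowLedger`: on a good orbit and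
one window `[s, s+w]`, the entropy production `−(Str + Col)` of the one-window balance (C0) is bounded by the frozen kinetic
channel `−∫Σ lo_s`, the cubic channel `|∫Σ hi_s|`, the frozen collisional identification term `∫Σ P_s − Σ_coll K_s` (fed to CC1
after the flow shift), and the two FREEZING errors: `C w ∫Σ(3 + 2‖v‖³)` for the streaming integrands (time-Lipschitz bounds of
`fast` and `P`) and `2B Σ_i A_i` for the collision kernel (contact-scale time-Lipschitz bound `B` of the kernel against the transfer
impulse, through S10 with the trivial clamp). Abstract in the integrands; no probability. prover-line-stmt-AtomisticToContinuum-14680-c2-0.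
-/

noncomputable section

namespace Summit.AtomisticToContinuum.HydrodynamicLimit.Theorems.ClampedCurrentsDockHeart

open scoped BigOperators ENNReal Classical Interval
open MeasureTheory Filter Set Topology InformationTheory
open Literature.MathematicalPhysics.KineticTheory Literature.Analysis.FluidPDE Literature.Analysis.FunctionSpaces
open Summit.AtomisticToContinuum.HydrodynamicLimit.Theorems

/-- **THE PATHWISE BOOKKEEPING OF ONE WINDOW.** See the file header. [cite: Yau1991, §3] -/
theorem heart_pathwise {σ : ℝ} {N : ℕ} (Φ : HardSphereFlow (Torus.geometry (Fin 3)) (hsDiameter σ N) (N + 1))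
    (hσ : 0 < σ) (hσ2 : σ < 1 / 2)
    {Dg P fast : ℝ → T3 × V3 → ℝ} {lo hi : T3 × V3 → ℝ}
    {Kt Ks : HardSphereCollisionRecord (Fin 3) T3 (N + 1) → ℝ} {s w Cfz B : ℝ}
    (hw : 0 < w) (hCfz : 0 ≤ Cfz)
    (hDP : ∀ r ∈ Icc s (s + w), ∀ y, Dg r y = fast r y - P r y)
    (hlohi : ∀ y, fast s y = lo y + hi y)
    (hPc : Continuous (P s)) (hlo : Continuous lo) (hhi : Continuous hi)
    (hfz1 : ∀ r ∈ Icc s (s + w), ∀ y : T3 × V3, |fast r y - fast s y| ≤ Cfz * |r - s| * (1 + ‖y.2‖ ^ 3))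
    (hfz2 : ∀ r ∈ Icc s (s + w), ∀ y : T3 × V3, |P r y - P s y| ≤ Cfz * |r - s| * (1 + ‖y.2‖ ^ 2))
    {z : Config (N + 1) (Fin 3) T3} (hz : z ∈ Φ.good)
    (hDg : IntervalIntegrable (fun r => ∑ i, Dg r (Φ.flow r z i)) volume s (s + w))
    (hK : ∀ t ∈ collisionTimes (Torus.geometry (Fin 3)) (hsDiameter σ N) (fun t => Φ.flow t z) ∩ Ioc s (s + w),
      ∀ p ∈ contactPairs (Torus.geometry (Fin 3)) (hsDiameter σ N) (Φ.flow t z),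
      |Kt (HardSphereCollisionRecord.ofConfig (Torus.geometry (Fin 3)) (hsDiameter σ N) (Φ.flow t z) t p.1 p.2) -
          Ks (HardSphereCollisionRecord.ofConfig (Torus.geometry (Fin 3)) (hsDiameter σ N) (Φ.flow t z) t p.1 p.2)| ≤
        B * (‖(HardSphereCollisionRecord.ofConfig (Torus.geometry (Fin 3)) (hsDiameter σ N)
                (Φ.flow t z) t p.1 p.2).postVel.1 -
              (HardSphereCollisionRecord.ofConfig (Torus.geometry (Fin 3)) (hsDiameter σ N)
                (Φ.flow t z) t p.1 p.2).preVel.1‖ +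
          |‖(HardSphereCollisionRecord.ofConfig (Torus.geometry (Fin 3)) (hsDiameter σ N)
                (Φ.flow t z) t p.1 p.2).postVel.1‖ ^ 2 -
              ‖(HardSphereCollisionRecord.ofConfig (Torus.geometry (Fin 3)) (hsDiameter σ N)
                (Φ.flow t z) t p.1 p.2).preVel.1‖ ^ 2| / 2)) :
    -((∫ r in s..(s + w), ∑ i, Dg r (Φ.flow r z i)) + Φ.collisionSum (Ioc s (s + w)) Kt z) ≤
      -(∫ r in s..(s + w), ∑ i, lo (Φ.flow r z i)) + |∫ r in s..(s + w), ∑ i, hi (Φ.flow r z i)| +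
        ((∫ r in s..(s + w), ∑ i, P s (Φ.flow r z i)) - Φ.collisionSum (Ioc s (s + w)) Ks z) +
        Cfz * w * (∫ r in s..(s + w), ∑ i, (3 + 2 * ‖(Φ.flow r z i).2‖ ^ 3)) +
        2 * B * ∑ i, Φ.collisionSum (Ioc s (s + w)) (fun c => if c.fst = i then
          ‖c.postVel.1 - c.preVel.1‖ + |‖c.postVel.1‖ ^ 2 - ‖c.preVel.1‖ ^ 2| / 2 else 0) z := by
  have hsw : s ≤ s + w := le_add_of_nonneg_right hw.le
  -- the five time functions along the orbit
  set T : ℝ → ℝ := fun r => ∑ i, Dg r (Φ.flow r z i) with hT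
  set A : ℝ → ℝ := fun r => ∑ i, fast s (Φ.flow r z i) with hA
  set Bf : ℝ → ℝ := fun r => ∑ i, P s (Φ.flow r z i) with hBf
  set L : ℝ → ℝ := fun r => ∑ i, lo (Φ.flow r z i) with hL
  set Hh : ℝ → ℝ := fun r => ∑ i, hi (Φ.flow r z i) with hHh
  set gb : ℝ → ℝ := fun r => ∑ i, (3 + 2 * ‖(Φ.flow r z i).2‖ ^ 3) with hgb
  have hfast_c : Continuous (fast s) := by
    have : fast s = fun y => lo y + hi y := funext hlohi
    rw [this]; exact hlo.add hhi
  have hA_int : IntervalIntegrable A volume s (s + w) := ClampedCurrentsDockCollisionalIdPrelim.intervalIntegrable_sum_orbit Φ hz hfast_c s (s + w)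
  have hB_int : IntervalIntegrable Bf volume s (s + w) := ClampedCurrentsDockCollisionalIdPrelim.intervalIntegrable_sum_orbit Φ hz hPc s (s + w)
  have hL_int : IntervalIntegrable L volume s (s + w) := ClampedCurrentsDockCollisionalIdPrelim.intervalIntegrable_sum_orbit Φ hz hlo s (s + w)
  have hH_int : IntervalIntegrable Hh volume s (s + w) := ClampedCurrentsDockCollisionalIdPrelim.intervalIntegrable_sum_orbit Φ hz hhi s (s + w)
  have hgb_int : IntervalIntegrable gb volume s (s + w) :=
    ClampedCurrentsDockCollisionalIdPrelim.intervalIntegrable_sum_orbit Φ hz (F := fun y : T3 × V3 => 3 + 2 * ‖y.2‖ ^ 3) (by fun_prop) s (s + w)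
  -- the streaming integral split
  have hAB_int : IntervalIntegrable (fun r => A r - Bf r) volume s (s + w) := hA_int.sub hB_int
  have hD_int : IntervalIntegrable (fun r => T r - (A r - Bf r)) volume s (s + w) := hDg.sub hAB_int
  have hsplit : ∫ r in s..(s + w), T r = (∫ r in s..(s + w), (A r - Bf r)) + ∫ r in s..(s + w), (T r - (A r - Bf r)) := by
    rw [← intervalIntegral.integral_add hAB_int hD_int]
    exact intervalIntegral.integral_congr fun r _ => by ring
  have hABeq : ∫ r in s..(s + w), (A r - Bf r) = (∫ r in s..(s + w), A r) - ∫ r in s..(s + w), Bf r :=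
    intervalIntegral.integral_sub hA_int hB_int
  have hAeq : ∫ r in s..(s + w), A r = (∫ r in s..(s + w), L r) + ∫ r in s..(s + w), Hh r := by
    rw [← intervalIntegral.integral_add hL_int hH_int]
    refine intervalIntegral.integral_congr fun r _ => ?_
    simp only [hA, hL, hHh, ← Finset.sum_add_distrib]
    exact Finset.sum_congr rfl fun i _ => hlohi _
  -- the streaming freezing error
  have hD : |∫ r in s..(s + w), (T r - (A r - Bf r))| ≤ ∫ r in s..(s + w), Cfz * w * gb r := by
    have h := intervalIntegral.norm_integral_le_of_norm_le hsw (f := fun r => T r - (A r - Bf r))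
      (g := fun r => Cfz * w * gb r) (ae_of_all _ fun r hr => ?_) (hgb_int.const_mul _)
    · simpa only [Real.norm_eq_abs] using h
    · have hrI : r ∈ Icc s (s + w) := Ioc_subset_Icc_self hr
      have hrs : |r - s| ≤ w := by rw [abs_of_nonneg (by linarith [hr.1])]; linarith [hr.2]
      rw [Real.norm_eq_abs]
      simp only [hT, hA, hBf, hgb, ← Finset.sum_sub_distrib, Finset.mul_sum]
      refine (Finset.abs_sum_le_sum_abs _ _).trans (Finset.sum_le_sum fun i _ => ?_)
      set y := Φ.flow r z i
      have h1 := hfz1 r hrI y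
      have h2 := hfz2 r hrI y
      have hv2 : ‖y.2‖ ^ 2 ≤ 1 + ‖y.2‖ ^ 3 := KacPair.sq_le_one_add_cube (norm_nonneg _)
      have hv3 : 0 ≤ ‖y.2‖ ^ 3 := by positivity
      rw [hDP r hrI y, show fast r y - P r y - (fast s y - P s y) = (fast r y - fast s y) - (P r y - P s y) by ring]
      refine (abs_sub _ _).trans ?_
      have h3 : Cfz * |r - s| * (1 + ‖y.2‖ ^ 3) ≤ Cfz * w * (1 + ‖y.2‖ ^ 3) := by gcongr
      have h4 : Cfz * |r - s| * (1 + ‖y.2‖ ^ 2) ≤ Cfz * w * (2 + ‖y.2‖ ^ 3) := by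
        calc Cfz * |r - s| * (1 + ‖y.2‖ ^ 2) ≤ Cfz * w * (1 + ‖y.2‖ ^ 2) := by gcongr
          _ ≤ Cfz * w * (2 + ‖y.2‖ ^ 3) := mul_le_mul_of_nonneg_left (by linarith) (mul_nonneg hCfz hw.le)
      nlinarith [h1, h2, h3, h4, mul_nonneg hCfz hw.le]
  -- the collision sum: frozen kernel plus the kernel freezing error through S10 with the trivial clamp
  have hfin : (collisionTimes (Torus.geometry (Fin 3)) (hsDiameter σ N) (fun t => Φ.flow t z) ∩
      Ioc s (s + w)).Finite := Φ.finite_collisionTimes_inter hz Ioc_subset_Icc_self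
  have hεreg : (Torus.geometry (Fin 3)).IsHardSphereRegular (hsDiameter σ N) :=
    Torus.isHardSphereRegular_geometry ((hsDiameter_le hσ.le N).trans_lt (hσ2.trans_eq (by norm_num)))
  have hCol : Φ.collisionSum (Ioc s (s + w)) Kt z = Φ.collisionSum (Ioc s (s + w)) Ks z +
      Φ.collisionSum (Ioc s (s + w)) (fun c => (1 - (0 : ℝ) * 0) * (Kt c - Ks c)) z := by
    simp only [HardSphereFlow.collisionSum_eq, collisionSum_eq_finset_sum hfin, ← Finset.sum_add_distrib]
    refine Finset.sum_congr rfl fun t _ => Finset.sum_congr rfl fun p _ => by ring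
  have hRem : |Φ.collisionSum (Ioc s (s + w)) (fun c => (1 - (0 : ℝ) * 0) * (Kt c - Ks c)) z| ≤
      2 * B * ∑ i, Φ.collisionSum (Ioc s (s + w)) (fun c => if c.fst = i then
          ‖c.postVel.1 - c.preVel.1‖ + |‖c.postVel.1‖ ^ 2 - ‖c.preVel.1‖ ^ 2| / 2 else 0) z := by
    have h := ClampedCurrentsDockClampRemainder.abs_collisionSum_unclamped_le_transfer (ω := fun _ : Fin (N + 1) => (0 : ℝ))
      (g := fun c => Kt c - Ks c) hεreg hfin (fun _ => le_rfl) (fun _ => zero_le_one) hK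
    simpa only [HardSphereFlow.collisionSum_eq, sub_zero, one_mul] using h
  -- assembly
  have hnegH : -(∫ r in s..(s + w), Hh r) ≤ |∫ r in s..(s + w), Hh r| := neg_le_abs _
  have hD' : -(∫ r in s..(s + w), (T r - (A r - Bf r))) ≤
      Cfz * w * ∫ r in s..(s + w), ∑ i, (3 + 2 * ‖(Φ.flow r z i).2‖ ^ 3) := by
    rw [← intervalIntegral.integral_const_mul]
    exact (neg_le_abs _).trans hD
  have hRem' := (neg_le_abs (Φ.collisionSum (Ioc s (s + w)) (fun c => (1 - (0 : ℝ) * 0) * (Kt c - Ks c)) z)).trans hRem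
  rw [hCol, hsplit, hABeq, hAeq]
  linarith

end Summit.AtomisticToContinuum.HydrodynamicLimit.Theorems.ClampedCurrentsDockHeart

end
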